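import Summits.ResolutionOfSingularities.ResolutionOfSingularities.Theorems.FrobeniusClosingPatchingRelPerfectDepthMixedTargetsJCompositions
import Summits.ResolutionOfSingularities.ResolutionOfSingularities.Theorems.FrobeniusClosingPatchingRelPerfectDepthPointwisePairGameHolds
import Summits.ResolutionOfSingularities.ResolutionOfSingularities.Theorems.FrobeniusClosingPatchingRelPerfectDepthSNCPointwiseCongr
import Literature.AlgebraicGeometry.Resolution.PermissibleCentres
import Literature.AlgebraicGeometry.Resolution.MonomialOrderReductionCanonicalComap
import Literature.AlgebraicGeometry.Resolution.PointCentrePermissible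
import Literature.AlgebraicGeometry.Resolution.RegularBlowup
import Literature.AlgebraicGeometry.Resolution.BlowupAxialPoint
import Literature.AlgebraicGeometry.Resolution.BlowupsIntegral
import Literature.AlgebraicGeometry.Resolution.BlowupsComposition
import Literature.AlgebraicGeometry.Resolution.EmbeddedCurvePointBlowups
import Literature.AlgebraicGeometry.Resolution.MonomialOrderReductionUnit
import Literature.AlgebraicGeometry.Resolution.KollarOrderReduction
import Literature.AlgebraicGeometry.Resolution.BlowupDisjointCentreWeights
import Literature.AlgebraicGeometry.Hironaka2017.Proofs.S06BaseHike.U33L29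
import Literature.AlgebraicGeometry.Resolution.ExceptionalDivisorProjectiveBundle
import Literature.AlgebraicGeometry.Resolution.SubschemeRegularStalks
import Literature.AlgebraicGeometry.Resolution.ProjectiveSpaceRegular
import Literature.AlgebraicGeometry.Resolution.AdicCompletionRegular
import Literature.AlgebraicGeometry.Resolution.RegularLocalRingsProofs
import Literature.AlgebraicGeometry.Resolution.BlowupsScaling
import Summits.ResolutionOfSingularities.ResolutionOfSingularities.Theorems.FrobeniusClosingPatchingRelPerfectMonomialFormat
import Summits.ResolutionOfSingularities.ResolutionOfSingularities.Theorems.FrobeniusClosingPatchingRelPerfectDepthOneExceptionalFormat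
import HarnessLib

/-!
# Crux `PatchingRelPerfect` (stmt-ResolutionOfSingularities-16161), chain W5.2 — rung «r-cone-ℓ», the LADDER I: the END of the
# vertex-blowup ladder (two-monomial pair game off the vertex) and the transport of simple normal crossings

[OURS · L1 W5.2 · rung tool] Replaces the role of NO printed item; NOT a statement of the manuscript under review; fact-free.
AI-written (AI review is weaker than expert review).

The rung «r-cone-ℓ» (`(x₀x₁ + x₂²) + 𝔪^{ℓ+2} ∈ 𝒞` for EVERY `ℓ`, `S` regular local of dimension `4`, any characteristic, any residue
field) is proved by a LADDER of blowings up of closed points (the successive vertices of the strict transforms of the quadric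
cone), followed by the tree's pointwise two-monomial pair game.  This file:
* `coneEnd` — the END: if `I𝒪_X = M · (mono A ⊔ mono B)` on a regular Noetherian modification `g : X → Spec S` (blowing up
  cosupported in the closed point), `M` locally principal, the common boundary of `A`, `B` having simple normal crossings at every
  point of the cosupport, then the conclusion of the blow-up-form core holds for every `T = Bl_I Spec S`
  (`DepthTargets.pointwisePairGame_holds` + `MonomialCleanup.centreSeq_exists_isBlowup_comp_supported` + `atomConclusion_of_tower`);
* `sncWithAt_map_of_isIso` — simple normal crossings at a point transport through an isomorphism of stalks, member by member
  along any assignment `τ` of new members with the pulled-back stalks;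
* small bookkeeping on the ideal `𝓘_{{z}}` of a closed point (`le_vanishingIdeal_singleton_pow`, support lemmas).
-/

set_option linter.dupNamespace false

noncomputable section

open CategoryTheory CategoryTheory.Limits AlgebraicGeometry TopologicalSpace IsLocalRing
open Literature.AlgebraicGeometry.Resolution
open Scheme.IdealSheafData

namespace Summit.ResolutionOfSingularities.ResolutionOfSingularities.Theorems

universe u

namespace ConeDepth

/-! ## §1 The END: a host with simple normal crossings along the cosupport -/

/-- **END OF THE LADDER.**  Let `g : X ⟶ Spec S` be a blowing up along an ideal sheaf cosupported in the closed point, `X` regular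
and Noetherian, and suppose `I𝒪_X = M · (mono A ⊔ mono B)` with `M` locally principal, `A` and `B` two exponent lists on the same
boundary, that boundary having simple normal crossings at every point of the cosupport of `mono A ⊔ mono B`, itself lying over the
closed point.  Then the conclusion of the blow-up-form core holds for every `T = Bl_I Spec S`: the pointwise pair game
(`pointwisePairGame_holds`) principalises `mono A ⊔ mono B` by blowing up regular strata over the cosupport, the centres compose with
`g` to one blowing up cosupported in the closed point (`centreSeq_exists_isBlowup_comp_supported`), and the tower contracts
(`atomConclusion_of_tower`). [cite: Kollar2007, (3.111) Step 3] [cite: StacksProject, Tag 080A] -/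
theorem coneEnd {S : Type u} [CommRing S] [IsRegularLocalRing S] {I : Ideal S} (hI : I ≠ ⊥)
    {X : Scheme.{u}} [IsNoetherian X] (hX : Scheme.IsRegular X) {g : X ⟶ Spec (.of S)}
    (hg : ∃ K₀ : (Spec (.of S)).IdealSheafData, IsBlowup g K₀ ∧
      (K₀.support : Set (Spec (.of S))) ⊆ {IsLocalRing.closedPoint S})
    {M : X.IdealSheafData} (hM : IsLocallyPrincipal M) (A B : List (X.IdealSheafData × ℕ))
    (hAB : boundaryOf A = boundaryOf B)
    (hsnc : ∀ x : X, x ∈ (monomialIdeal A ⊔ monomialIdeal B).support → DepthSNC.SNCWithAt (boundaryOf A) ⊤ x)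
    (hsupp : ((monomialIdeal A ⊔ monomialIdeal B).support : Set X) ⊆ g ⁻¹' {IsLocalRing.closedPoint S})
    (hfmt : (affineBlowup.idealSheaf I).comap g = M * (monomialIdeal A ⊔ monomialIdeal B))
    (T : Scheme.{u}) (f : T ⟶ Spec (.of S)) (hf : IsBlowup f (affineBlowup.idealSheaf I)) :
    ∃ (J : T.IdealSheafData) (T' : Scheme.{u}) (π : T' ⟶ T), J ≠ ⊥ ∧
      (∀ t : T, t ∈ J.support → f.base t = IsLocalRing.closedPoint S) ∧
      IsBlowup π J ∧ Scheme.IsRegular T' := by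
  obtain ⟨s, -, hover, htop, hlp⟩ := DepthTargets.pointwisePairGame_holds X hX A B hAB hsnc
  obtain ⟨Q, hQ, hQT⟩ := MonomialCleanup.centreSeq_exists_isBlowup_comp_supported s g
    {IsLocalRing.closedPoint S} hg (CentreSeq.CentresOver.mono s hsupp hover)
  refine atomConclusion_of_tower hI hQ hQT htop ?_ T f hf
  rw [Scheme.IdealSheafData.comap_comp, hfmt, comap_mul]
  exact (hM.comap s.comp).mul hlp

/-! ## §2 Transport of simple normal crossings through a stalk isomorphism -/

/-- **Simple normal crossings at a point transport through an isomorphism of stalks, member by member**: if `π_{x'}^♯` is an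
isomorphism, `E` has simple normal crossings at `π x'`, and every member `τ D` (`D ∈ E`) of the new family through `x'` has
the stalk `π_{x'}^♯(D_{π x'})`, then `E.map τ ++ extra` has simple normal crossings at `x'` for any `extra` members missing
`x'` (the regular system of parameters is carried over by the isomorphism; the assignment of members to parameters is pulled
back along `τ`). [cite: Kollar2007, Def. 3.25] [cite: StacksProject, Tag 02OS] -/
theorem sncWithAt_map_of_isIso {X' X : Scheme.{u}} {π : X' ⟶ X} (x' : X') [IsIso (π.stalkMap x')]
    {E : List X.IdealSheafData} {C : X.IdealSheafData} (hE : DepthSNC.SNCWithAt E C (π x'))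
    (τ : X.IdealSheafData → X'.IdealSheafData)
    (hτ : ∀ D ∈ E, x' ∈ (τ D).support → stalkIdeal (τ D) x' = (stalkIdeal D (π x')).map (π.stalkMap x').hom)
    (extra : List X'.IdealSheafData) (hextra : ∀ D' ∈ extra, x' ∉ D'.support) :
    DepthSNC.SNCWithAt (E.map τ ++ extra) ⊤ x' := by
  classical
  let e : X.presheaf.stalk (π x') ≃+* X'.presheaf.stalk x' := (asIso (π.stalkMap x')).commRingCatIsoToRingEquiv
  have he : (e : X.presheaf.stalk (π x') →+* X'.presheaf.stalk x') = (π.stalkMap x').hom := rfl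
  obtain ⟨hreg, d, u, hd, hu, ⟨ι, hι, hιD⟩, -⟩ := hE
  haveI := hreg
  haveI hreg' : IsRegularLocalRing (X'.presheaf.stalk x') := IsRegularLocalRing.of_ringEquiv e
  refine ⟨hreg', d, fun i => e (u i), ?_, ?_, ?_, ?_⟩
  · rw [← map_ringEquiv_maximalIdeal e, Ideal.spanFinrank_map_eq_of_ringEquiv, hd]
  · have hr : Set.range (fun i => e (u i)) = e '' Set.range u := Set.range_comp _ u
    rw [hr, ← Ideal.map_span e, hu, map_ringEquiv_maximalIdeal]
  · -- every member through `x'` is `τ D` for a member `D` of `E` through `π x'`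
    have key : ∀ D' : {D' // D' ∈ E.map τ ++ extra ∧ x' ∈ D'.support},
        ∃ D : {D // D ∈ E ∧ π x' ∈ D.support}, τ D.1 = D'.1 := by
      rintro ⟨D', hD'E, hx'⟩
      rcases List.mem_append.mp hD'E with h | h
      · obtain ⟨D, hD, rfl⟩ := List.mem_map.mp h
        refine ⟨⟨D, hD, ?_⟩, rfl⟩
        rw [mem_support_iff_stalkIdeal_ne_top] at hx' ⊢
        intro htop
        apply hx'
        rw [hτ D hD (by rwa [mem_support_iff_stalkIdeal_ne_top]), htop, Ideal.map_top]
      · exact absurd hx' (hextra D' h)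
    choose g hg using key
    refine ⟨fun D' => ι (g D'), ?_, ?_⟩
    · intro D₁ D₂ heq
      have h2 : g D₁ = g D₂ := hι heq
      apply Subtype.ext
      rw [← hg D₁, ← hg D₂, h2]
    · intro D'
      have hmem : (g D').1 ∈ E := (g D').2.1
      have hx'τ : x' ∈ (τ (g D').1).support := by rw [hg D']; exact D'.2.2
      have h1 : stalkIdeal D'.1 x' = stalkIdeal (τ (g D').1) x' := by rw [hg D']
      rw [h1, hτ _ hmem hx'τ, ← he, hιD (g D'), Ideal.map_span, Set.image_singleton]
      rfl
  · intro hx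
    rw [Scheme.IdealSheafData.support_top] at hx
    exact absurd hx id

/-! ## §3 Small bookkeeping: ideal sheaves below a power of the ideal of a closed point -/

/-- An ideal sheaf whose stalk at the closed point `z` lies in `𝔪_z^n` lies in `𝓘_{{z}}^n` (stalkwise: off `z` the right
side is the unit ideal). [folklore] -/
theorem le_vanishingIdeal_singleton_pow {X : Scheme.{u}} {z : X} (hz : IsClosed ({z} : Set X))
    (D : X.IdealSheafData) (n : ℕ) (h : stalkIdeal D z ≤ maximalIdeal (X.presheaf.stalk z) ^ n) :
    D ≤ vanishingIdeal (⟨{z}, hz⟩ : Closeds X) ^ n := by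
  refine le_of_forall_stalkIdeal_le fun x => ?_
  rw [stalkIdeal_pow]
  by_cases hx : x = z
  · subst hx
    rwa [stalkIdeal_vanishingIdeal_singleton hz]
  · have hx' : x ∉ (vanishingIdeal (⟨{z}, hz⟩ : Closeds X)).support := by
      rw [← SetLike.mem_coe, Scheme.IdealSheafData.coe_support_vanishingIdeal]
      exact hx
    rw [stalkIdeal_eq_top_of_not_mem_support hx', Ideal.top_pow]
    exact le_top

/-- The support of the ideal of a closed point is the point. [folklore] -/
theorem mem_support_vanishingIdeal_singleton_iff {X : Scheme.{u}} {z : X} (hz : IsClosed ({z} : Set X)) (x : X) :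
    x ∈ (vanishingIdeal (⟨{z}, hz⟩ : Closeds X)).support ↔ x = z := by
  rw [← SetLike.mem_coe, Scheme.IdealSheafData.coe_support_vanishingIdeal]
  exact Set.mem_singleton_iff

/-- Points of `V(K𝒪_{X'})` are the points over `V(K)` (membership form of Mathlib's `support_comap`). [folklore] -/
theorem mem_support_comap_iff_apply {X' X : Scheme.{u}} (f : X' ⟶ X) (K : X.IdealSheafData) (x : X') :
    x ∈ (K.comap f).support ↔ f x ∈ K.support := by
  rw [Scheme.IdealSheafData.support_comap]
  rfl

end ConeDepth

end Summit.ResolutionOfSingularities.ResolutionOfSingularities.Theorems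

end
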